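import Literature.Geometry.Riemannian.BoundaryCylinderSliceData
import HarnessLib

/-!
# The boundary cylinder at `t = 0` for a second metric: mean curvature
# (Bär–Hanke 2023, §3, (7)–(8), proof of Prop. 28)

Topic `Literature/Geometry/Riemannian`. Third brick of the proof of
`Literature.Geometry.Riemannian.BarHanke2023_prop28_meanCurvatureIncrease` (Bär–Hanke, §3,
Prop. 28). In boundary normal coordinates `E : ∂M × (-ε, ε) → P` of the extension `ĝ` of `g_M`
(`BoundaryCylinderMetric.lean`) Bär–Hanke's deformed metrics `f(s) = g - sδψ(t) g_0` are again
generalized cylinders `dt² + g'_t` for the SAME coordinate `t`, so their boundary data are read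
through the same map `E` while the metric on `P` changes. This file provides the corresponding
generalization of `boundaryCylinder_sliceZero_meanCurvature` (`BoundaryCylinderSliceData.lean`):

* `boundaryCylinder_sliceZero_meanCurvature_of_metric` — with `E` the `ĝ`-normal exponential tube
  map, a second metric `g₂` on `P` inducing `g_M` along `jM`, and a cylinder metric `G = E^* g₂`
  on the slab: `H^G_{t=0}(z) = -H_{g_M}(incl, ν_M)(z)` (mean curvature of the slice w.r.t. `∂_t`
  versus the outward mean curvature of `∂M ⊂ (M, g_M)`).

The proof is that of the one-metric statement verbatim (naturality of the mean curvature under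
local isometries, O'Neill 1983, Ch. 3, Prop. 3.59; `dE_{(z,0)}(0, 1) = d(jM)(-ν_M z)`).
No definitions, no named facts (D-0026).

## References

* C. Bär, B. Hanke, *Boundary conditions for scalar curvature*, arXiv:2012.09127, §3, (7)–(8)
  and proof of Prop. 28. [BarHanke2023]
* B. O'Neill, *Semi-Riemannian geometry* (1983), Ch. 3, Prop. 3.59; Ch. 4, Lemma 4.4 ff.
  [ONeill1983]
-/

noncomputable section

open Bundle Set Function Filter Metric
open scoped Manifold ContDiff Topology

attribute [-instance] SimplexCategory.instFintypeToTypeOrderHomFinHAddNatLenOfNat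

namespace Literature.Geometry.Riemannian

open Literature.Geometry.Lorentzian Literature.Geometry.Lorentzian.PseudoRiemannianMetric

section SliceZero

open Literature.Topology.FourManifolds

universe u

variable {n : ℕ} {M : Type u} [TopologicalSpace M] [ChartedSpace (EuclideanHalfSpace (n + 2)) M]
  [IsManifold (𝓡∂ (n + 2)) ∞ M]
  {P : Type u} [TopologicalSpace P] [ChartedSpace (EuclideanSpace ℝ (Fin (n + 2))) P]
  [IsManifold (𝓡 (n + 2)) ∞ P] [T2Space P]
  (bM : BoundaryData (𝓡∂ (n + 2)) M (𝓡 (n + 1)))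

set_option synthInstance.maxHeartbeats 400000 in
set_option maxHeartbeats 3200000 in
/-- **The mean curvature of the slice `t = 0` of a boundary cylinder, for a second metric.**
Generalization of `boundaryCylinder_sliceZero_meanCurvature` (Bär–Hanke 2023, §3, (7)–(8)) in
which the tube map `E(z, t) = exp^{ĝ}_{jM(incl z)}(t · d(jM)(-ν_M z))` is the normal exponential
map of ONE metric `ĝ = g` on `P`, while the metric data belong to ANOTHER metric `g₂` on `P`:
if `g₂(djM ·, djM ·) = g_M` along the equidimensional embedding `jM : M → P` and the cylinder
metric `G` on `∂M × ℝ` agrees with `E^* g₂` on the slab `|t| < ε` (where `E` is `C^∞` with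
injective differential), then the mean curvature of the slice `y ↦ (y, 0)` of `(∂M × ℝ, G)`
w.r.t. `∂_t` is `-H_{g_M}(incl, ν_M)`. (Used for the deformed metrics of Bär–Hanke's Prop. 28,
which are again of the form `dt² + g'_t` in the normal coordinates of the UNDEFORMED metric, so
that `E` stays the same map while the metric changes.) Proof verbatim as for one metric:
naturality of `H` under the local isometries `E|_{slab} : (slab, G) → (P, g₂)` and
`jM : (M, g_M) → (P, g₂)` (`meanCurvature_comap`, O'Neill 1983, Ch. 3, Prop. 3.59), `E(·, 0) = jM ∘ incl`,
`dE(∂_t) = d(jM)(-ν_M)` (`mfderiv_normalExp_zero_apply'` for `g`), and `H_{-ν} = -H_ν`.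
[cite: BarHanke2023, §3, (7)–(8) and proof of Prop. 28] [cite: ONeill1983, Ch. 3, Prop. 3.59 and Ch. 4, Lemma 4.4] -/
theorem boundaryCylinder_sliceZero_meanCurvature_of_metric {jM : M → P}
    (hjM : Manifold.IsSmoothEmbedding (𝓡∂ (n + 2)) (𝓡 (n + 2)) ∞ jM)
    (gM : PseudoRiemannianMetric (𝓡∂ (n + 2)) ∞ (EuclideanSpace ℝ (Fin (n + 2)))
      (TangentSpace (𝓡∂ (n + 2)) : M → Type _)) [gM.HasLeviCivita]
    (hfM : gM.IsSpacelikeImmersion (𝓡 (n + 1)) bM.incl)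
    (νM : NormalField (𝓡∂ (n + 2)) bM.incl)
    (hνs : ContMDiff (𝓡 (n + 1)) (𝓡∂ (n + 2)).tangent ∞ (fun z ↦
      (TotalSpace.mk' (EuclideanSpace ℝ (Fin (n + 2))) (bM.incl z) (νM z) :
        TangentBundle (𝓡∂ (n + 2)) M)))
    (g : PseudoRiemannianMetric (𝓡 (n + 2)) ∞ (EuclideanSpace ℝ (Fin (n + 2)))
      (TangentSpace (𝓡 (n + 2)) : P → Type _)) [g.HasLeviCivita]
    (g₂ : PseudoRiemannianMetric (𝓡 (n + 2)) ∞ (EuclideanSpace ℝ (Fin (n + 2)))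
      (TangentSpace (𝓡 (n + 2)) : P → Type _)) [g₂.HasLeviCivita]
    (hpull : ∀ (a : M) (v w : TangentSpace (𝓡∂ (n + 2)) a),
      g₂.val (jM a) (mfderiv (𝓡∂ (n + 2)) (𝓡 (n + 2)) jM a v)
        (mfderiv (𝓡∂ (n + 2)) (𝓡 (n + 2)) jM a w) = gM.val a v w)
    (G : PseudoRiemannianMetric ((𝓡 (n + 1)).prod 𝓘(ℝ, ℝ)) ∞
      (EuclideanSpace ℝ (Fin (n + 1)) × ℝ)
      (TangentSpace ((𝓡 (n + 1)).prod 𝓘(ℝ, ℝ)) : bM.carrier × ℝ → Type _)) [G.HasLeviCivita]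
    (hG : G.IsRiemannian) {ε : ℝ} (hε : 0 < ε)
    (hEs : ∀ q : bM.carrier × ℝ, q.2 ∈ Ioo (-ε) ε →
      ContMDiffAt ((𝓡 (n + 1)).prod 𝓘(ℝ, ℝ)) (𝓡 (n + 2)) ∞
        (fun q : bM.carrier × ℝ ↦ expMap g.leviCivita (jM (bM.incl q.1))
          (q.2 • mfderiv (𝓡∂ (n + 2)) (𝓡 (n + 2)) jM (bM.incl q.1) (-νM q.1))) q)
    (hEinj : ∀ q : bM.carrier × ℝ, q.2 ∈ Ioo (-ε) ε →
      Injective (mfderiv ((𝓡 (n + 1)).prod 𝓘(ℝ, ℝ)) (𝓡 (n + 2))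
        (fun q : bM.carrier × ℝ ↦ expMap g.leviCivita (jM (bM.incl q.1))
          (q.2 • mfderiv (𝓡∂ (n + 2)) (𝓡 (n + 2)) jM (bM.incl q.1) (-νM q.1))) q))
    (hGval : ∀ (z : bM.carrier), ∀ t ∈ Ioo (-ε) ε,
      G.val (z, t) = pullbackBilin (I := 𝓡 (n + 2)) (I' := (𝓡 (n + 1)).prod 𝓘(ℝ, ℝ))
        (fun q : bM.carrier × ℝ ↦ expMap g.leviCivita (jM (bM.incl q.1))
          (q.2 • mfderiv (𝓡∂ (n + 2)) (𝓡 (n + 2)) jM (bM.incl q.1) (-νM q.1))) g₂.val (z, t))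
    (z : bM.carrier) :
    G.meanCurvature (fun y : bM.carrier ↦ ((y, (0 : ℝ)) : bM.carrier × ℝ))
        (contMDiff_pullbackBilin_holds (I := (𝓡 (n + 1)).prod 𝓘(ℝ, ℝ))
          (M := bM.carrier × ℝ) (I' := 𝓡 (n + 1)) (N := bM.carrier))
        (isSpacelikeImmersion_cylSlice G hG 0)
        (fun y ↦ velocity ((𝓡 (n + 1)).prod 𝓘(ℝ, ℝ))
          (fun s : ℝ ↦ ((y, s) : bM.carrier × ℝ)) 0) z =
      -gM.meanCurvature bM.incl
        (contMDiff_pullbackBilin_holds (I := 𝓡∂ (n + 2)) (M := M) (I' := 𝓡 (n + 1))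
          (N := bM.carrier)) hfM νM z := by
  haveI : Fact (1 ≤ (∞ : ℕ∞ω)) := ⟨by exact_mod_cast le_top⟩
  haveI h1 : CovariantDerivative.ContMDiffCovariantDerivative g.leviCivita 1 :=
    contMDiffCovariantDerivative_leviCivita_of_two_le g (WithTop.coe_le_coe.2 le_top)
  set I2 := (𝓡 (n + 1)).prod 𝓘(ℝ, ℝ) with hI2
  set T : bM.carrier × ℝ → P := fun q ↦ expMap g.leviCivita (jM (bM.incl q.1))
    (q.2 • mfderiv (𝓡∂ (n + 2)) (𝓡 (n + 2)) jM (bM.incl q.1) (-νM q.1)) with hT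
  set ι : bM.carrier → P := fun y ↦ jM (bM.incl y) with hι
  set ν : Π y : bM.carrier, TangentSpace (𝓡 (n + 2)) (ι y) :=
    fun y ↦ mfderiv (𝓡∂ (n + 2)) (𝓡 (n + 2)) jM (bM.incl y) (-νM y) with hν
  have hjMs : ContMDiff (𝓡∂ (n + 2)) (𝓡 (n + 2)) ∞ jM := hjM.contMDiff
  have hincl : ContMDiff (𝓡 (n + 1)) (𝓡∂ (n + 2)) ∞ bM.incl := bM.isSmoothEmbedding.contMDiff
  have htan : ContMDiff (𝓡∂ (n + 2)).tangent (𝓡 (n + 2)).tangent 1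
      (tangentMap (𝓡∂ (n + 2)) (𝓡 (n + 2)) jM) :=
    hjMs.contMDiff_tangentMap (by exact WithTop.coe_le_coe.2 le_top)
  have hν2lift : ContMDiff (𝓡 (n + 1)) (𝓡 (n + 2)).tangent 1
      (fun y ↦ (TotalSpace.mk' (EuclideanSpace ℝ (Fin (n + 2))) (ι y)
        (mfderiv (𝓡∂ (n + 2)) (𝓡 (n + 2)) jM (bM.incl y) (νM y)) :
        TangentBundle (𝓡 (n + 2)) P)) :=
    htan.comp (hνs.of_le (by exact_mod_cast le_top))
  have hνlift : ContMDiff (𝓡 (n + 1)) (𝓡 (n + 2)).tangent 1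
      (fun y ↦ (TotalSpace.mk' (EuclideanSpace ℝ (Fin (n + 2))) (ι y) (ν y) :
        TangentBundle (𝓡 (n + 2)) P)) :=
    htan.comp ((contMDiff_totalSpaceMk_neg hνs).of_le (by exact_mod_cast le_top))
  have hνneglift : ContMDiff (𝓡 (n + 1)) (𝓡 (n + 2)).tangent 1
      (fun y ↦ (TotalSpace.mk' (EuclideanSpace ℝ (Fin (n + 2))) (ι y)
        (-mfderiv (𝓡∂ (n + 2)) (𝓡 (n + 2)) jM (bM.incl y) (νM y)) :
        TangentBundle (𝓡 (n + 2)) P)) :=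
    contMDiff_totalSpaceMk_neg hν2lift
  have hyint : (𝓡 (n + 1)).IsInteriorPoint z := BoundarylessManifold.isInteriorPoint
  -- the pulled-back identity `ĝ(djM ·, djM ·) = g_M` as an equality of metrics
  have hjMinj : ∀ a : M, Injective (mfderiv (𝓡∂ (n + 2)) (𝓡 (n + 2)) jM a) := fun a ↦
    injective_mfderiv_of_isImmersionAt' (hjM.isImmersion.isImmersionAt a)
  set gJ := g₂.comap (contMDiff_pullbackBilin_holds (I := 𝓡 (n + 2)) (M := P)
    (I' := 𝓡∂ (n + 2)) (N := M)) jM hjMs hjMinj rfl with hgJ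
  haveI := gJ.hasLeviCivita
  have hgJ_eq : gJ = gM :=
    metric_ext' fun a ↦ ContinuousLinearMap.ext fun v ↦ ContinuousLinearMap.ext fun w ↦ by
      rw [hgJ, val_comap, pullbackBilin_apply, hpull]
  have hfJ : gJ.IsSpacelikeImmersion (𝓡 (n + 1)) bM.incl := by rw [hgJ_eq]; exact hfM
  -- `jM ∘ incl` is a spacelike immersion of `(P, ĝ)`
  have hchain : ∀ (y : bM.carrier) (v : TangentSpace (𝓡 (n + 1)) y),
      mfderiv (𝓡 (n + 1)) (𝓡 (n + 2)) (jM ∘ bM.incl) y v =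
        mfderiv (𝓡∂ (n + 2)) (𝓡 (n + 2)) jM (bM.incl y)
          (mfderiv (𝓡 (n + 1)) (𝓡∂ (n + 2)) bM.incl y v) := by
    intro y v
    rw [mfderiv_comp y ((hjMs _).mdifferentiableAt (by simp))
      ((hincl y).mdifferentiableAt (by simp))]
    rfl
  have hιsp : g₂.IsSpacelikeImmersion (𝓡 (n + 1)) (jM ∘ bM.incl) := by
    refine ⟨hjMs.comp hincl, fun y v hv ↦ ?_⟩
    show 0 < g₂.val (jM (bM.incl y)) (mfderiv (𝓡 (n + 1)) (𝓡 (n + 2)) (jM ∘ bM.incl) y v)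
      (mfderiv (𝓡 (n + 1)) (𝓡 (n + 2)) (jM ∘ bM.incl) y v)
    rw [hchain, hpull]
    exact hfM.2 y v hv
  -- (F) naturality along `jM`: `H^ĝ_{jM ∘ incl, djM ν_M} = H^{g_M}_{incl, ν_M}`
  have hF : g₂.meanCurvature (jM ∘ bM.incl)
      (contMDiff_pullbackBilin_holds (I := 𝓡 (n + 2)) (M := P) (I' := 𝓡 (n + 1))
        (N := bM.carrier)) hιsp
      (fun y ↦ mfderiv (𝓡∂ (n + 2)) (𝓡 (n + 2)) jM (bM.incl y) (νM y)) z =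
      gM.meanCurvature bM.incl
        (contMDiff_pullbackBilin_holds (I := 𝓡∂ (n + 2)) (M := M) (I' := 𝓡 (n + 1))
          (N := bM.carrier)) hfM νM z := by
    have key := meanCurvature_comap g₂ _ hjMs hjMinj rfl
      (contMDiff_pullbackBilin_holds (I := 𝓡∂ (n + 2)) (M := M) (I' := 𝓡 (n + 1))
        (N := bM.carrier))
      (contMDiff_pullbackBilin_holds (I := 𝓡 (n + 2)) (M := P) (I' := 𝓡 (n + 1))
        (N := bM.carrier)) hfJ hιsp (ν := νM) hyint ((hνs z).mdifferentiableAt (by simp))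
    rw [← key]
    exact meanCurvature_congr_metric' hgJ_eq bM.incl _ hfJ hfM νM z
  -- the open slab `W = ∂M × (-ε, ε)` and the two honest pullback metrics on it
  have h0 : (0 : ℝ) ∈ Ioo (-ε) ε := ⟨by linarith, hε⟩
  have hUo : IsOpen ((univ : Set bM.carrier) ×ˢ Ioo (-ε) ε) := isOpen_univ.prod isOpen_Ioo
  set W : TopologicalSpace.Opens (bM.carrier × ℝ) :=
    ⟨(univ : Set bM.carrier) ×ˢ Ioo (-ε) ε, hUo⟩ with hW
  have hmemW : ∀ u : W, u.1.2 ∈ Ioo (-ε) ε := fun u ↦ u.2.2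
  set Φ : W → P := T ∘ Subtype.val with hΦdef
  have hTu : ∀ u : W, MDifferentiableAt I2 (𝓡 (n + 2)) T u.1 := fun u ↦
    (hEs u.1 (hmemW u)).mdifferentiableAt (by simp)
  have hΦ : ContMDiff I2 (𝓡 (n + 2)) (∞ + 1) Φ := fun u ↦
    (hEs u.1 (hmemW u)).comp u (contMDiff_subtype_val u)
  have hΦ' : ∀ u, Injective (mfderiv I2 (𝓡 (n + 2)) Φ u) := fun u ↦ by
    rw [hΦdef, mfderiv_comp_subtypeVal (hTu u)]
    exact hEinj u.1 (hmemW u)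
  have hιW : ContMDiff I2 I2 (∞ + 1) (Subtype.val : W → bM.carrier × ℝ) := contMDiff_subtype_val
  have hιW' : ∀ u : W, Injective (mfderiv I2 I2 (Subtype.val : W → bM.carrier × ℝ) u) :=
    fun u ↦ by
    rw [mfderiv_subtypeVal]
    exact fun v w h ↦ h
  have hdim : Module.finrank ℝ (EuclideanSpace ℝ (Fin (n + 1)) × ℝ) =
      Module.finrank ℝ (EuclideanSpace ℝ (Fin (n + 2))) := by
    rw [finrank_cylModel, finrank_euclideanSpace, finrank_euclideanSpace, Fintype.card_fin,
      Fintype.card_fin]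
  set gΦ := g₂.comap (contMDiff_pullbackBilin_holds (I := 𝓡 (n + 2)) (M := P) (I' := I2)
    (N := W)) Φ hΦ hΦ' hdim with hgΦ
  set GW := G.comap (contMDiff_pullbackBilin_holds (I := I2) (M := bM.carrier × ℝ) (I' := I2)
    (N := W)) Subtype.val hιW hιW' rfl with hGW
  haveI := gΦ.hasLeviCivita
  haveI := GW.hasLeviCivita
  have hvals : gΦ = GW := by
    refine metric_ext' fun u ↦ ContinuousLinearMap.ext fun v ↦ ContinuousLinearMap.ext fun w ↦ ?_
    obtain ⟨⟨z', t'⟩, hu⟩ := u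
    show pullbackBilin (I := 𝓡 (n + 2)) (I' := I2) Φ g₂.val ⟨(z', t'), hu⟩ v w =
      pullbackBilin (I := I2) (I' := I2) (Subtype.val : W → bM.carrier × ℝ) G.val
        ⟨(z', t'), hu⟩ v w
    rw [pullbackBilin_apply, pullbackBilin_apply, hΦdef, mfderiv_comp_subtypeVal
      (hTu ⟨(z', t'), hu⟩), mfderiv_subtypeVal, hGval z' t' hu.2, pullbackBilin_apply]
    rfl
  -- the slice `t = 0` as a map into `W`, its differential, and the field `∂_t` along it
  set sl : bM.carrier → W := fun y ↦ ⟨((y, (0 : ℝ)) : bM.carrier × ℝ), ⟨mem_univ _, h0⟩⟩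
    with hsl
  have hsl_val : (Subtype.val ∘ sl) = fun y : bM.carrier ↦ ((y, (0 : ℝ)) : bM.carrier × ℝ) :=
    rfl
  have hsls : ContMDiff (𝓡 (n + 1)) I2 ∞ sl := by
    rw [← ContMDiff.subtypeVal_comp_iff W sl, hsl_val]
    exact contMDiff_cylSlice (I' := 𝓡 (n + 1)) 0
  set νc : Π y : bM.carrier, TangentSpace I2 (((y, (0 : ℝ)) : bM.carrier × ℝ)) :=
    fun y ↦ velocity I2 (fun s : ℝ ↦ ((y, s) : bM.carrier × ℝ)) 0 with hνc
  have hνc_lift : ContMDiff (𝓡 (n + 1)) I2.tangent ∞ (fun y ↦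
      (TotalSpace.mk' (EuclideanSpace ℝ (Fin (n + 1)) × ℝ) ((y, (0 : ℝ)) : bM.carrier × ℝ)
        (νc y) : TangentBundle I2 (bM.carrier × ℝ))) :=
    contMDiff_lift_velocity_cylSlice (I' := 𝓡 (n + 1)) (N := bM.carrier) 0
  have hνW : MDifferentiableAt (𝓡 (n + 1)) I2.tangent
      (fun y ↦ (TotalSpace.mk' (EuclideanSpace ℝ (Fin (n + 1)) × ℝ) (sl y) (νc y) :
        TangentBundle I2 W)) z :=
    (mdifferentiableAt_totalSpace_opens_iff' W (b := sl) (s := νc)).2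
      ((hνc_lift z).mdifferentiableAt (by simp))
  have hvsl : G.IsSpacelikeImmersion (𝓡 (n + 1)) (Subtype.val ∘ sl) :=
    isSpacelikeImmersion_cylSlice G hG 0
  have hfW : GW.IsSpacelikeImmersion (𝓡 (n + 1)) sl := by
    refine ⟨hsls, fun y v hv ↦ ?_⟩
    rw [hGW, inducedBilin_comap G _ hιW hιW' rfl ((hsls y).mdifferentiableAt (by simp))
      (hasMFDerivAt_subtypeVal (sl y)).mdifferentiableAt]
    exact hvsl.2 y v hv
  have hfΦ : gΦ.IsSpacelikeImmersion (𝓡 (n + 1)) sl := by rw [hvals]; exact hfW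
  have hΦsl : g₂.IsSpacelikeImmersion (𝓡 (n + 1)) (Φ ∘ sl) := by
    have hΦinf : ContMDiff I2 (𝓡 (n + 2)) ∞ Φ := hΦ
    refine ⟨hΦinf.comp hsls, fun y v hv ↦ ?_⟩
    rw [← inducedBilin_comap g₂ _ hΦ hΦ' hdim ((hsls y).mdifferentiableAt (by simp))
      ((hΦinf (sl y)).mdifferentiableAt (by simp))]
    exact hfΦ.2 y v hv
  -- (A) restriction to the slab: `H^{G|_W} = H^G`
  have hA : GW.meanCurvature sl
      (contMDiff_pullbackBilin_holds (I := I2) (M := W) (I' := 𝓡 (n + 1)) (N := bM.carrier))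
      hfW (fun y ↦ νc y) z =
      G.meanCurvature (fun y : bM.carrier ↦ ((y, (0 : ℝ)) : bM.carrier × ℝ))
        (contMDiff_pullbackBilin_holds (I := I2) (M := bM.carrier × ℝ) (I' := 𝓡 (n + 1))
          (N := bM.carrier))
        (isSpacelikeImmersion_cylSlice G hG 0) νc z := by
    have key := meanCurvature_comap G _ hιW hιW' rfl
      (contMDiff_pullbackBilin_holds (I := I2) (M := W) (I' := 𝓡 (n + 1)) (N := bM.carrier))
      (contMDiff_pullbackBilin_holds (I := I2) (M := bM.carrier × ℝ) (I' := 𝓡 (n + 1))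
        (N := bM.carrier)) hfW hvsl (ν := fun y ↦ νc y) hyint hνW
    rw [key]
    exact meanCurvature_congr_fun G hsl_val (fun y ↦ by rw [mfderiv_subtypeVal]; rfl) _ hvsl
      _ z
  -- (B) the two pullback metrics on the slab agree
  have hB : gΦ.meanCurvature sl
      (contMDiff_pullbackBilin_holds (I := I2) (M := W) (I' := 𝓡 (n + 1)) (N := bM.carrier))
      hfΦ (fun y ↦ νc y) z =
      GW.meanCurvature sl
        (contMDiff_pullbackBilin_holds (I := I2) (M := W) (I' := 𝓡 (n + 1)) (N := bM.carrier))
        hfW (fun y ↦ νc y) z :=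
    meanCurvature_congr_metric' hvals sl _ hfΦ hfW _ z
  -- (C) naturality along `E|_W`
  have hC : gΦ.meanCurvature sl
      (contMDiff_pullbackBilin_holds (I := I2) (M := W) (I' := 𝓡 (n + 1)) (N := bM.carrier))
      hfΦ (fun y ↦ νc y) z =
      g₂.meanCurvature (Φ ∘ sl)
        (contMDiff_pullbackBilin_holds (I := 𝓡 (n + 2)) (M := P) (I' := 𝓡 (n + 1))
          (N := bM.carrier)) hΦsl (fun y ↦ mfderiv I2 (𝓡 (n + 2)) Φ (sl y) (νc y)) z :=
    meanCurvature_comap g₂ _ hΦ hΦ' hdim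
      (contMDiff_pullbackBilin_holds (I := I2) (M := W) (I' := 𝓡 (n + 1)) (N := bM.carrier))
      (contMDiff_pullbackBilin_holds (I := 𝓡 (n + 2)) (M := P) (I' := 𝓡 (n + 1))
        (N := bM.carrier)) hfΦ hΦsl hyint hνW
  -- (D) `E(·, 0) = jM ∘ incl` and `dE(∂_t) = d(jM)(-ν_M)`
  have hΦsl_eq : (Φ ∘ sl) = (jM ∘ bM.incl) := by
    funext y
    show expMap g.leviCivita (ι y) ((0 : ℝ) • ν y) = ι y
    exact normalExp_zero (cov := g.leviCivita) y
  have hdT1 : ∀ y : bM.carrier,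
      mfderiv I2 (𝓡 (n + 2)) (fun q : bM.carrier × ℝ ↦ expMap g.leviCivita (ι q.1) (q.2 • ν q.1))
        (y, 0) ((((0 : EuclideanSpace ℝ (Fin (n + 1))), (1 : ℝ))) :
          TangentSpace I2 (y, (0 : ℝ))) = ν y := by
    intro y
    have h := mfderiv_normalExp_zero_apply' (cov := g.leviCivita) (k := 1) le_rfl hνlift y 0 1
    rw [map_zero, zero_add, one_smul] at h
    exact h
  have hνeq : ∀ y : bM.carrier,
      (mfderiv I2 (𝓡 (n + 2)) Φ (sl y) (νc y) : EuclideanSpace ℝ (Fin (n + 2))) = ν y := by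
    intro y
    rw [hΦdef, mfderiv_comp_subtypeVal (hTu (sl y))]
    show mfderiv I2 (𝓡 (n + 2)) T (y, 0)
      (velocity I2 (fun s : ℝ ↦ ((y, s) : bM.carrier × ℝ)) 0) = ν y
    rw [velocity_cylLine]
    exact hdT1 y
  have hD : g₂.meanCurvature (Φ ∘ sl)
      (contMDiff_pullbackBilin_holds (I := 𝓡 (n + 2)) (M := P) (I' := 𝓡 (n + 1))
        (N := bM.carrier)) hΦsl (fun y ↦ mfderiv I2 (𝓡 (n + 2)) Φ (sl y) (νc y)) z =
      g₂.meanCurvature (jM ∘ bM.incl)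
        (contMDiff_pullbackBilin_holds (I := 𝓡 (n + 2)) (M := P) (I' := 𝓡 (n + 1))
          (N := bM.carrier)) hιsp (fun y ↦ ν y) z :=
    meanCurvature_congr_fun g₂ hΦsl_eq hνeq _ hΦsl hιsp z
  -- (E) `H_{-ν} = -H_ν`
  have hE : g₂.meanCurvature (jM ∘ bM.incl)
      (contMDiff_pullbackBilin_holds (I := 𝓡 (n + 2)) (M := P) (I' := 𝓡 (n + 1))
        (N := bM.carrier)) hιsp (fun y ↦ ν y) z =
      -g₂.meanCurvature (jM ∘ bM.incl)
        (contMDiff_pullbackBilin_holds (I := 𝓡 (n + 2)) (M := P) (I' := 𝓡 (n + 1))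
          (N := bM.carrier)) hιsp
        (fun y ↦ mfderiv (𝓡∂ (n + 2)) (𝓡 (n + 2)) jM (bM.incl y) (νM y)) z := by
    have h1 : g₂.meanCurvature (jM ∘ bM.incl)
        (contMDiff_pullbackBilin_holds (I := 𝓡 (n + 2)) (M := P) (I' := 𝓡 (n + 1))
          (N := bM.carrier)) hιsp (fun y ↦ ν y) z =
        g₂.meanCurvature (jM ∘ bM.incl)
          (contMDiff_pullbackBilin_holds (I := 𝓡 (n + 2)) (M := P) (I' := 𝓡 (n + 1))
            (N := bM.carrier)) hιsp
          (fun y ↦ -mfderiv (𝓡∂ (n + 2)) (𝓡 (n + 2)) jM (bM.incl y) (νM y)) z :=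
      meanCurvature_congr_fun g₂ rfl (fun y ↦ by
        show mfderiv (𝓡∂ (n + 2)) (𝓡 (n + 2)) jM (bM.incl y) (-νM y) = _
        rw [map_neg]) _ hιsp hιsp z
    rw [h1]
    exact meanCurvature_neg_normal g₂ _ hιsp hyint ((hν2lift z).mdifferentiableAt one_ne_zero)
      ((hνneglift z).mdifferentiableAt one_ne_zero)
  -- assemble
  rw [← hA, ← hB, hC, hD, hE, hF]
end SliceZero

end Literature.Geometry.Riemannian
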